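import Literature.Computability.AlgebraicComplexity.ValiantClasses
import Literature.Computability.AlgebraicComplexity.ConstantFreeCircuits
import HarnessLib

/-!
# `VP` is closed under p-projections: discharge of `IsVPFamily.of_isPProjection`

D-0014 keeps `Literature/` sorry-free by stating cited results as named facts `def X : Prop`.
This sibling file of `Literature.Computability.AlgebraicComplexity.ValiantClasses` proves, from
the definitions alone, that Valiant's class `VP` is closed under p-projections among p-families
(Bürgisser 2000, §2.1 and Rem. 2.7; Bürgisser–Clausen–Shokrollahi 1997, Rem. (21.13)(2), p. 548:
"The classes **VP** and **VNP** are closed under p-projections"):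

* `complexity_le_of_isProjection`: a projection does not increase the circuit complexity,
  `L(f(a₁, …, a_m)) ≤ L(f)` for `aᵢ ∈ k ∪ {X_j}` (Bürgisser 2000, Rem. 2.7) — the content of the
  named fact `IsProjection.complexity_le` of `ValiantClasses.lean`;
* `IsPComputable.of_isPProjection_holds`: **discharge** of `IsPComputable.of_isPProjection` — a
  p-projection of a p-computable family is p-computable;
* `IsVPFamily.of_isPProjection_holds`: **discharge** of `IsVPFamily.of_isPProjection` — a
  p-family that is a p-projection of a family in `VP` is in `VP`.

## The printed proof and the one formalised

BCS 1997, Rem. (21.13)(2) (p. 548) and Bürgisser 2000, §2.1 record the closure without proof;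
the reason is the remark (Bürgisser 2000, Rem. 2.7) that substituting variables and constants
for the inputs of a straight-line program for `f_{t(n)}` gives one of the same length for
`g_n = f_{t(n)}(a₁, …, a_m)`, so that `L(g_n) ≤ L(f_{t(n)})`, which is p-bounded in `n` because
`t` and `m ↦ L(f_m)` are (p-bounded functions compose). The p-family condition on `g` is a
hypothesis, not a conclusion: BCS 1997, Def. (21.12)(2) (p. 547) defines `f ≤_p g` between
p-families only, and a p-projection bounds neither the number of variables of `g_n` nor makes
it a p-family (docstring of `IsVPFamily.of_isPProjection`).

Formally: a fan-in-two circuit `P` of size `L(f)` computing `f`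
(`ArithCircuit.exists_computes_size_eq_complexity`, `ArithCircuitProofs.lean`) becomes the
substitution circuit `P.substCircuit [] ρ` (`ConstantFreeCircuits.lean`) with empty prefix and
`ρ i` the operand `var j`, resp. `const c`, according as `a i = X j` or `a i = C c`; it has the
same size and fan-in (`size_substCircuit`, `IsFanInTwo.substCircuit`) and computes `aeval a f`
(`eval_substCircuit`), whence `L(aeval a f) ≤ L(f)` (`complexity_le_size`). The family statements
then follow by `IsPBounded.comp_holds` and `IsPBounded.mono` (`ValiantClasses.lean`), exactly as
in the interim proofs preserved as comments in `ValiantClasses.lean`.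

## Design notes

* `complexity_le_of_isProjection` has the same statement and proof as
  `IsProjection.complexity_le_holds` of `RealTauConjectureDepthFour.lean`, which needs it for
  Tavenas' Prop. 3.21 and imports the depth-reduction and Koiran–Tavenas developments. It is
  re-proved here, under a distinct name (so the two modules stay co-importable), in order that the
  basic closure properties of `VP` depend only on the circuit calculus (`ArithCircuitProofs.lean`,
  `ConstantFreeCircuits.lean`); a librarian may later dedupe in favour of this copy.
* Nothing is stated stronger than the source: `complexity` is the gate count of fan-in-two
  circuits (Bürgisser's `L_k` up to a factor `≤ 3`, see its docstring), and substitution of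
  variables and constants is literally free for that count, as in Rem. 2.7.
* Imports: `ValiantClasses` (the facts) and `ConstantFreeCircuits` (substitution circuits; it
  imports `ArithCircuitProofs`). No new definitions.

## `VP ⊆ VQP` (discharge of `VP_subset_VQP`)

The last section proves the named fact `VP_subset_VQP` of `ValiantClasses.lean`
(`VP_subset_VQP_holds`). Bürgisser–Clausen–Shokrollahi 1997, §21.5 (p. 562) records it as
"Obviously, VP ⊆ VQP" right after Def. (21.31) of qp-bounded functions and of `VQP`; Bürgisser
2000, §2.5 likewise. The only content is `IsPBounded.isQPBounded`: a p-bounded function is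
quasi-polynomially bounded in the tree's form `t n ≤ 2 ^ ((log₂ n + c') ^ c')` of `IsQPBounded` —
from `n < 2 ^ (log₂ n + 1)` and `c ≤ 2 ^ c` one gets `n ^ c + c ≤ 2 ^ (c (log₂ n + 1) + c + 1)`,
and that exponent is at most `(log₂ n + c') ^ 2 ≤ (log₂ n + c') ^ c'` for `c' = 2c + 2`. The
predicate form is `IsVPFamily.isVQPFamily`.

## References

* P. Bürgisser, *Completeness and Reduction in Algebraic Complexity Theory*, Algorithms and
  Computation in Mathematics 7, Springer 2000, Def. 2.1, §2.1 (p-projections, `VP`), Rem. 2.7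
  (projections do not increase complexity), Def. 2.26 and §2.5 (`VQP`, `VP ⊆ VQP`).
* P. Bürgisser, M. Clausen, M. A. Shokrollahi, *Algebraic Complexity Theory*, Grundlehren 315,
  Springer 1997, Def. (21.12) p. 547, Rem. (21.13)(2) p. 548, Def. (21.31) and the remark following it
  ("Obviously, VP ⊆ VQP"), §21.5, p. 562.
* L. G. Valiant, *Completeness classes in algebra*, Proc. 11th STOC (1979), 249–261.
-/

noncomputable section

open MvPolynomial

namespace Literature.Computability.AlgebraicComplexity

universe u v w

open ArithCircuit

/-! ### Projections are free (Bürgisser 2000, Rem. 2.7) -/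

section Projection

variable {k : Type u} [CommSemiring k] {σ : Type v} {τ : Type w}

/-- **Projections are free**: if `g = f(a₁, …, a_m)` with every `aᵢ` a variable or a constant
(`IsProjection g f`), then `L(g) ≤ L(f)` — substitute the `aᵢ` for the inputs of a minimal
fan-in-two circuit for `f`, at no cost in gates (Bürgisser 2000, Rem. 2.7; this is the content of
the named fact `IsProjection.complexity_le`). Twin, with the same proof, of
`IsProjection.complexity_le_holds` in `RealTauConjectureDepthFour.lean` (distinct name: the two
modules stay co-importable). [cite: Burgisser2000, Rem. 2.7] -/
theorem complexity_le_of_isProjection {g : MvPolynomial τ k} {f : MvPolynomial σ k}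
    (h : IsProjection g f) : complexity g ≤ complexity f := by
  classical
  obtain ⟨a, ha, rfl⟩ := h
  obtain ⟨P, hP1, hP2, hP3⟩ := exists_computes_size_eq_complexity f
  let ρ : σ → Operand k τ := fun i =>
    if hx : ∃ j, a i = X j then .var hx.choose else .const ((ha i).resolve_left hx).choose
  have hρ : ∀ i ws, (ρ i).eval (gateValues ([] : List (Gate k τ)) ++ ws) = a i := by
    intro i ws
    by_cases hx : ∃ j, a i = X j
    · simp only [ρ, dif_pos hx, Operand.eval]
      exact hx.choose_spec.symm
    · simp only [ρ, dif_neg hx, Operand.eval]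
      exact ((ha i).resolve_left hx).choose_spec.symm
  have hcomp : (P.substCircuit [] ρ).Computes (aeval a f) := by
    rw [Computes] at hP2 ⊢
    rw [eval_substCircuit P [] hρ, hP2]
  calc complexity (aeval a f) ≤ (P.substCircuit [] ρ).size :=
        complexity_le_size (hP1.substCircuit (by simp) ρ) hcomp
    _ = complexity f := by rw [size_substCircuit, List.length_nil, zero_add, hP3]

end Projection

/-! ### Discharges: `VP` is closed under p-projections (Bürgisser 2000, §2.1) -/

section Families

variable {k : Type u} [CommSemiring k] {σ : ℕ → Type v} {τ : ℕ → Type w}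

/-- **Discharge of `IsPComputable.of_isPProjection`**: a p-projection `g` of a p-computable
family `f` is p-computable — `L(g_n) ≤ L(f_{t(n)})` since projections are free
(`complexity_le_of_isProjection`; Bürgisser 2000, Rem. 2.7), and `n ↦ L(f_{t(n)})` is p-bounded
as the composite of the p-bounded functions `m ↦ L(f_m)` and `t` (`IsPBounded.comp_holds`). This
is the interim proof preserved in `ValiantClasses.lean`, fed with the discharges; no p-family
hypothesis is needed for the complexity bound. [cite: Burgisser2000, Rem. 2.7] -/
theorem IsPComputable.of_isPProjection_holds :
    IsPComputable.of_isPProjection (k := k) (σ := σ) (τ := τ) := by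
  intro g f hgf hf
  obtain ⟨t, ht, hproj⟩ := hgf
  exact (IsPBounded.comp_holds hf ht).mono fun n => complexity_le_of_isProjection (hproj n)

variable [∀ n, Fintype (σ n)] [∀ n, Fintype (τ n)]

/-- **Discharge of `IsVPFamily.of_isPProjection`** (`VP` is closed under p-projections among
p-families): if `g` is a p-family and a p-projection of `f ∈ VP`, then `g ∈ VP` — `g` is a
p-family by hypothesis and p-computable by `IsPComputable.of_isPProjection_holds`
(Bürgisser 2000, §2.1 with Rem. 2.7; Bürgisser–Clausen–Shokrollahi 1997, Rem. (21.13)(2),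
p. 548: "The classes VP and VNP are closed under p-projections", where by Def. (21.12)(2)
`≤_p` relates p-families). [cite: Burgisser2000, §2.1] -/
theorem IsVPFamily.of_isPProjection_holds :
    IsVPFamily.of_isPProjection (k := k) (σ := σ) (τ := τ) :=
  fun hg hgf hf => ⟨hg, IsPComputable.of_isPProjection_holds hgf hf.2⟩

end Families

/-! ### Discharge: `VP ⊆ VQP` (BCS 1997, §21.5, Def. (21.31); Bürgisser 2000, §2.5) -/

namespace IsPBounded

/-- A p-bounded function is quasi-polynomially bounded: if `t n ≤ n ^ c + c` for all `n`, then
`t n ≤ 2 ^ ((log₂ n + c') ^ c')` with `c' = 2c + 2` — the observation behind "Obviously,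
VP ⊆ VQP" (Bürgisser–Clausen–Shokrollahi 1997, §21.5, remark after Def. (21.31), p. 562;
Bürgisser 2000, §2.5). Self-contained twin of the strict form `IsPBounded.exists_lt_two_pow` of
`VPDeterminantalQPProofs.lean` (not imported here: that module carries the determinantal
complexity development). [cite: BurgisserClausenShokrollahi1997, Def. (21.31) and remark, p. 562]
[cite: Burgisser2000, §2.5] -/
theorem isQPBounded {t : ℕ → ℕ} (ht : IsPBounded t) : IsQPBounded t := by
  obtain ⟨c, hc⟩ := ht
  refine ⟨2 * c + 2, fun n => (hc n).trans ?_⟩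
  -- Step 1: `n ^ c ≤ 2 ^ (c * (log₂ n + 1))` from `n < 2 ^ (log₂ n + 1)`.
  have hn : n ^ c ≤ 2 ^ (c * (Nat.log 2 n + 1)) :=
    calc n ^ c ≤ (2 ^ (Nat.log 2 n + 1)) ^ c :=
          Nat.pow_le_pow_left (Nat.lt_pow_succ_log_self Nat.one_lt_two n).le c
      _ = 2 ^ (c * (Nat.log 2 n + 1)) := by rw [← pow_mul, Nat.mul_comm]
  -- Step 2: absorb the additive constant, `c ≤ 2 ^ c`, into the exponent.
  have hc2 : c ≤ 2 ^ c := (Nat.lt_pow_self Nat.one_lt_two).le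
  have hsum : n ^ c + c ≤ 2 ^ (c * (Nat.log 2 n + 1) + c + 1) :=
    calc n ^ c + c ≤ 2 ^ (c * (Nat.log 2 n + 1)) + 2 ^ c := Nat.add_le_add hn hc2
      _ ≤ 2 ^ (c * (Nat.log 2 n + 1)) * 2 ^ c + 2 ^ (c * (Nat.log 2 n + 1)) * 2 ^ c :=
          Nat.add_le_add (Nat.le_mul_of_pos_right _ (Nat.two_pow_pos c))
            (Nat.le_mul_of_pos_left _ (Nat.two_pow_pos _))
      _ = 2 ^ (c * (Nat.log 2 n + 1) + c + 1) := by ring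
  refine hsum.trans (Nat.pow_le_pow_right Nat.two_pos ?_)
  -- Step 3: the exponent is at most `(log₂ n + c') ^ 2 ≤ (log₂ n + c') ^ c'`, `c' = 2c + 2`.
  have h1 : c * (Nat.log 2 n + 1) + c + 1 ≤ (c + 1) * (Nat.log 2 n + 2) := by
    rw [Nat.add_mul, Nat.one_mul, Nat.mul_add, Nat.mul_add]
    omega
  have h2 : (c + 1) * (Nat.log 2 n + 2) ≤
      (Nat.log 2 n + (2 * c + 2)) * (Nat.log 2 n + (2 * c + 2)) :=
    Nat.mul_le_mul (by omega) (by omega)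
  calc c * (Nat.log 2 n + 1) + c + 1
      ≤ (Nat.log 2 n + (2 * c + 2)) ^ 2 := by rw [pow_two]; exact h1.trans h2
    _ ≤ (Nat.log 2 n + (2 * c + 2)) ^ (2 * c + 2) := Nat.pow_le_pow_right (by omega) (by omega)

end IsPBounded

section VQP

variable {k : Type u} [CommSemiring k] {σ : ℕ → Type v} [∀ n, Fintype (σ n)]

/-- `VP ⊆ VQP` for predicates: a `VP` family is a `VQP` family, since its p-bounded complexity is
quasi-polynomially bounded (`IsPBounded.isQPBounded`; Bürgisser–Clausen–Shokrollahi 1997, §21.5,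
"Obviously, VP ⊆ VQP" after Def. (21.31), p. 562; Bürgisser 2000, §2.5).
[cite: BurgisserClausenShokrollahi1997, Def. (21.31) and remark, p. 562]
[cite: Burgisser2000, §2.5] -/
theorem IsVPFamily.isVQPFamily {f : ∀ n, MvPolynomial (σ n) k} (hf : IsVPFamily f) :
    IsVQPFamily f :=
  ⟨hf.1, IsPBounded.isQPBounded hf.2⟩

end VQP

/-- **Discharge of `VP_subset_VQP`**: unfold membership in `VP k`, `VQP k` and apply
`IsVPFamily.isVQPFamily` (Bürgisser 2000, §2.5; Bürgisser–Clausen–Shokrollahi 1997, §21.5,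
remark after Def. (21.31), p. 562: "Obviously, VP ⊆ VQP").
[cite: BurgisserClausenShokrollahi1997, Def. (21.31) and remark, p. 562]
[cite: Burgisser2000, §2.5] -/
theorem VP_subset_VQP_holds (k : Type u) [CommSemiring k] : VP_subset_VQP k :=
  fun _ hF => IsVPFamily.isVQPFamily hF

end Literature.Computability.AlgebraicComplexity
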